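import Summits.QuantumFields.YangMills.Theorems.ToronValleyVolumeLojasiewiczLocaliseRing
import Summits.QuantumFields.YangMills.Theorems.VirialFluxGapTwistEaterSignClass
import HarnessLib

/-!
# Route `VirialFluxGap` (YangMills): the CENTRAL half of the regular ∕ central dichotomy of the toron valley — a non-regular small-deficit ring
# history is near one of the sixteen CENTRAL torons

Companion of ✓`RegularValley.regular_linear_localise` (crux ⟨stmt-QuantumFields-24141⟩ `VirialFluxGap.PeriodicSoftness`; the Euler field of both
routes is built from two charts — REGULAR valley and CENTRAL cone — patched along the comb data of the history).  The comb data of a ring history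
`P` are the three wrap representatives `wrapReps(P₀)` of slice `0` in comb gauge and the seam value `P.2 0`.  If NONE of them is `ρ`-regular
(`1 − re(q)² ≤ ρ²` for all four: every comb holonomy within `≈ ρ` of `±1`), then `P` is within `4L√F₀ + 12L²√F₀ + 4ρ` per slice link and
`12L²√F₀ + 4ρ` per seam site (Frobenius) of a CENTRAL toron: all slices equal to `t⁻¹·combFlat(centreElem ∘ s)` (the comb gauge `t = treeGauge P₀`
of the history itself, signs `s : Fin 3 → Bool`) and a CONSTANT central seam `centreElem b` — ★★ `exists_central_flat_ring_near_of_central`.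
Mechanism: the skeleton of ✓`Lojasiewicz.exists_flat_ring_near` (fcl-p3 g33) with the almost-commuting step replaced by SNAPPING each comb
holonomy to the nearest centre element (`norm_su2Quat_sub_centreElem_le`: `‖q(V) − (±1)‖ ≤ 2ρ` when `1 − re(q(V))² ≤ ρ²`).  Together with the
regular half: every ring history is either `ρ`-regular (quadratic growth `F₀ ≥ ρ²·dist/(21520L⁸)`) or `poly(L)(√F₀ + ρ)`-close to one of the 16
central torons (where the quartic cone chart of ✓`ConstantHistory.ringDeficit_const_eq_commutator_quartic` takes over).

HONEST FRAMING: lattice bookkeeping; the Euler field, ⟨24141⟩, ⟨24497⟩, every rung and the Yang–Mills mass gap remain OPEN; no summit is proved by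
a line.  ROUTE-INDEPENDENT.  THEOREMS ONLY (no definition, no `sorry`), standard axioms.  Width seat `ym-line-sfw-p2-w2` g51 (cell ym-idea-1, free
hands), `--supports stmt-QuantumFields-24141`.  References: [cite: Luscher1983, §2].
-/

set_option autoImplicit false

noncomputable section

open scoped Quaternion Matrix BigOperators
open Literature.MathematicalPhysics.QuantumFieldTheory hiding SU2
open Literature.MathematicalPhysics.QuantumLattice

namespace Summit.QuantumFields.YangMills.Theorems.VirialFluxGap.RegularValley

open Summit.QuantumFields.YangMills.Theorems.FemtoTransferGap
open Summit.QuantumFields.YangMills.Theorems.FemtoTransferGap.TT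
open Summit.QuantumFields.YangMills.Theorems.FemtoTransferGap.TT.SectorSmooth
open Summit.QuantumFields.YangMills.Theorems.FemtoTransferGap.TwoLattice
open Summit.QuantumFields.YangMills.Theorems.FemtoTransferGap.TwoLattice.Flat
open Summit.QuantumFields.YangMills.Theorems.FemtoTransferGap.TwoLattice.Cov
open Summit.QuantumFields.YangMills.Theorems.VirialFluxGap.RingDeficit
open Summit.QuantumFields.YangMills.Theorems.ToronValleyVolume.Lojasiewicz
open Summit.QuantumFields.YangMills.Theorems.QuantitativeLaplace (su2Quat_centreElem)

variable {L : ℕ} [NeZero L]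

/-! ## §1 Snapping a near-central unit to the centre -/

omit [NeZero L] in
/-- ★ **Snapping to the centre**: if `1 − re(q(V))² ≤ ρ²` (`ρ ≥ 0`) then `‖q(V) − q(centreElem b)‖ ≤ 2ρ` for the sign `b = (re q(V) < 0)`
(`(1 − |re|)² ≤ 1 − re² = |Im|²`, so `‖q − (±1)‖² ≤ 2|Im|²`). [folklore] -/
theorem norm_su2Quat_sub_centreElem_le (V : SU2) {ρ : ℝ} (hρ : 0 ≤ ρ) (h : 1 - (su2Quat V).re ^ 2 ≤ ρ ^ 2) :
    ‖su2Quat V - su2Quat (centreElem (decide ((su2Quat V).re < 0)))‖ ≤ 2 * ρ := by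
  set q := su2Quat V with hq
  have hunit : q.re ^ 2 + (q.imI * q.imI + q.imJ * q.imJ + q.imK * q.imK) = 1 := by
    rw [← norm_sq_eq_re_sq_add_imDot, hq, norm_su2Quat, one_pow]
  have hre1 : |q.re| ≤ 1 := by
    have := imDot_self_nonneg q
    rw [← sq_le_one_iff_abs_le_one]; linarith
  have habs := abs_le.mp hre1
  -- the square of the distance is `(re ∓ 1)² + |Im|² ≤ 2(1 − re²)`
  have key : ‖q - su2Quat (centreElem (decide (q.re < 0)))‖ ^ 2 ≤ 2 * (1 - q.re ^ 2) := by
    rw [su2Quat_centreElem]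
    by_cases hneg : q.re < 0
    · have e : q - (if decide (q.re < 0) then (-1 : ℍ) else 1) = q + 1 := by simp [hneg]
      rw [e, norm_sq_eq_re_sq_add_imDot]
      simp only [Quaternion.re_add, Quaternion.imI_add, Quaternion.imJ_add, Quaternion.imK_add, Quaternion.re_one,
        Quaternion.imI_one, Quaternion.imJ_one, Quaternion.imK_one, add_zero]
      nlinarith [hunit, habs.1, mul_nonneg (by linarith : 0 ≤ 1 + q.re) (by linarith : 0 ≤ -q.re)]
    · have e : q - (if decide (q.re < 0) then (-1 : ℍ) else 1) = q - 1 := by simp [hneg]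
      rw [e, norm_sq_eq_re_sq_add_imDot]
      simp only [Quaternion.re_sub, Quaternion.imI_sub, Quaternion.imJ_sub, Quaternion.imK_sub, Quaternion.re_one,
        Quaternion.imI_one, Quaternion.imJ_one, Quaternion.imK_one, sub_zero]
      have hre0 : 0 ≤ q.re := le_of_not_gt hneg
      nlinarith [hunit, habs.2, mul_nonneg (by linarith : 0 ≤ 1 - q.re) hre0]
  have h2 : ‖q - su2Quat (centreElem (decide (q.re < 0)))‖ ^ 2 ≤ (2 * ρ) ^ 2 := by nlinarith [key, h]
  exact (pow_le_pow_iff_left₀ (norm_nonneg _) (by positivity) two_ne_zero).1 h2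

/-! ## §2 ★★ The central flat comparison ring -/

/-- ★★ **A CENTRAL toron near every non-regular small-deficit ring history.**  With `δ = √F₀(P)`: if all three wrap representatives `wrapReps(P₀)_k`
AND the seam value `P.2 0` satisfy `1 − re(q)² ≤ ρ²` (`ρ ≥ 0`), there are signs `s : Fin 3 → Bool`, `b : Bool` such that the central flat ring
`Q = (every slice = t⁻¹·combFlat(centreElem ∘ s), seam ≡ centreElem b)`, `t = treeGauge P₀`, has `F₀(Q) = 0`, slices within `4Lδ + 12L²δ + 4ρ`
of those of `P` on every link (Frobenius) and seam within `12L²δ + 4ρ` at every site. [cite: Luscher1983, §2] -/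
theorem exists_central_flat_ring_near_of_central (P : (Fin (2 * L - 1 + 1) → GaugeConfig 3 L SU2) × (Site 3 L → SU2)) {ρ : ℝ} (hρ : 0 ≤ ρ)
    (hcenW : ∀ k : Fin 3, 1 - (su2Quat (wrapReps (P.1 0) k)).re ^ 2 ≤ ρ ^ 2) (hcenS : 1 - (su2Quat (P.2 0)).re ^ 2 ≤ ρ ^ 2) :
    ∃ (s : Fin 3 → Bool) (b : Bool),
      ringDeficit L (fun _ => false)
        ((fun _ => gaugeTransform (treeGauge (P.1 0))⁻¹ (combFlat fun k => centreElem (s k))), fun _ => centreElem b) = 0 ∧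
      (∀ (i : Fin (2 * L - 1 + 1)) (e : Edge 3 L), fd (P.1 i e) (gaugeTransform (treeGauge (P.1 0))⁻¹ (combFlat fun k => centreElem (s k)) e) ≤
        4 * (L : ℝ) * Real.sqrt (ringDeficit L (fun _ => false) P) + 12 * (L : ℝ) ^ 2 * Real.sqrt (ringDeficit L (fun _ => false) P) + 4 * ρ) ∧
      (∀ x : Site 3 L, fd (P.2 x) (centreElem b) ≤ 12 * (L : ℝ) ^ 2 * Real.sqrt (ringDeficit L (fun _ => false) P) + 4 * ρ) := by
  set δ := Real.sqrt (ringDeficit L (fun _ => false) P) with hδ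
  have hδ0 : 0 ≤ δ := Real.sqrt_nonneg _
  have hL1 : (1 : ℝ) ≤ L := by exact_mod_cast NeZero.one_le
  have hL0 : (0 : ℝ) ≤ (L : ℝ) - 1 := by linarith
  set U : GaugeConfig 3 L SU2 := P.1 0 with hU
  set g : Site 3 L → SU2 := P.2 with hg
  set ρ' : ℝ := 4 * (L : ℝ) * δ with hρ'
  have hρ'0 : 0 ≤ ρ' := by positivity
  have hslice : ∀ i e, fd (P.1 i e) (U e) ≤ 4 * (L : ℝ) * δ := fun i e => fd_slice_zero_le' P i e
  have hseam : ∀ e, fd (U e) (gaugeTransform g U e) ≤ ρ' := fun e => fd_seam_zero_le P e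
  have hS : Real.sqrt (2 * wilsonAction su2Rep U) ≤ 2 * δ := sqrt_two_action_le P
  set t : Site 3 L → SU2 := treeGauge U with ht
  have hV : treeFix U = gaugeTransform t U := rfl
  set w : Fin 3 → SU2 := wrapReps U with hw
  have hVw : ∀ e, fd (treeFix U e) (combFlat w e) ≤ 12 * (L : ℝ) ^ 2 * δ := fun e => by
    refine (fd_treeFix_combFlat_le U e).trans ?_
    have h1 : ((L : ℝ) - 1) * ((6 * (L : ℝ) - 4) * Real.sqrt (2 * wilsonAction su2Rep U)) ≤ ((L : ℝ) - 1) * ((6 * (L : ℝ) - 4) * (2 * δ)) :=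
      mul_le_mul_of_nonneg_left (mul_le_mul_of_nonneg_left hS (by linarith)) hL0
    nlinarith [h1]
  -- the conjugated seam field nearly stabilises the comb-gauge slice
  set sf : Site 3 L → SU2 := fun x => t x * g x * (t x)⁻¹ with hsf
  have hsV : ∀ e, fd (treeFix U e) (gaugeTransform sf (treeFix U) e) ≤ ρ' := fun e => by
    rw [hV, hsf, gaugeTransform_conj_eq, fd_gaugeTransform_apply]; exact hseam e
  have hjump : ∀ e : Edge 3 L, treeEdge e = true → fd (sf (e.1.shift e.2)) (sf e.1) ≤ ρ' := by
    intro e he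
    have h1 := hsV e
    rw [treeFix_eq_one_of_treeEdge U he] at h1
    have e1 : gaugeTransform sf (treeFix U) e = sf e.1 * (sf (e.1.shift e.2))⁻¹ := by
      rw [show gaugeTransform sf (treeFix U) e = sf e.1 * treeFix U e * (sf (e.1.shift e.2))⁻¹ from rfl, treeFix_eq_one_of_treeEdge U he, mul_one]
    rw [e1, fd_comm, fd_mul_inv_one] at h1
    rwa [fd_comm]
  set c : SU2 := sf 0 with hc
  have hcg : c = g 0 := by rw [hc, hsf]; dsimp only; rw [ht, treeGauge_zero, one_mul, inv_one, mul_one]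
  have hsc : ∀ x, fd (sf x) c ≤ 3 * ((L : ℝ) - 1) * ρ' := fun x => by
    have := fd_sub_base_le_of_treeEdge hρ'0 hjump x
    rwa [hc]
  -- snapping the four comb holonomies to the centre
  let X : Option (Fin 3) → SU2 := fun o => Option.elim o c w
  have hXs : ∀ k : Fin 3, X (some k) = w k := fun k => rfl
  have hXn : X none = c := rfl
  let bb : Option (Fin 3) → Bool := fun o => decide ((su2Quat (X o)).re < 0)
  let Y : Option (Fin 3) → SU2 := fun o => centreElem (bb o)
  have hXcen : ∀ o, 1 - (su2Quat (X o)).re ^ 2 ≤ ρ ^ 2 := by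
    intro o
    rcases o with _ | k
    · rw [hXn, hcg, hg]; exact hcenS
    · rw [hXs, hw, hU]; exact hcenW k
  have hXY : ∀ o, fd (X o) (Y o) ≤ 4 * ρ := fun o => by
    refine (fd_le_two_mul_norm_su2Quat_sub (X o) (Y o)).trans ?_
    have := norm_su2Quat_sub_centreElem_le (X o) hρ (hXcen o)
    linarith
  have hYcen : ∀ o (x : SU2), x * Y o = Y o * x := fun o x => (Subgroup.mem_center_iff.mp (centreElem_mem_center (bb o)) x)
  -- the central flat ring
  set h' : Fin 3 → SU2 := fun k => Y (some k) with hh'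
  set c' : SU2 := Y none with hc'
  have hh'c : ∀ i j, h' i * h' j = h' j * h' i := fun i j => hYcen (some j) (h' i)
  have hc'h : ∀ k, c' * h' k = h' k * c' := fun k => (hYcen none (h' k)).symm
  set F : GaugeConfig 3 L SU2 := combFlat h' with hF
  have hSF : wilsonAction su2Rep F = 0 := wilsonAction_combFlat_eq_zero hh'c
  refine ⟨fun k => bb (some k), bb none, ?_, ?_, ?_⟩
  · -- deficit zero
    rw [ringDeficit_eq_sums, twist3_false]
    dsimp only
    have hseamQ : gaugeTransform (fun _ => centreElem (bb none)) (gaugeTransform t⁻¹ F) = gaugeTransform t⁻¹ F := by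
      funext e
      show centreElem (bb none) * gaugeTransform t⁻¹ F e * (centreElem (bb none))⁻¹ = gaugeTransform t⁻¹ F e
      rw [← hYcen none (gaugeTransform t⁻¹ F e), mul_inv_cancel_right]
    rw [show (combFlat fun k => centreElem (bb (some k))) = F from rfl, hseamQ, timeCoupling_deficit_self, wilsonAction_gaugeTransform, hSF]
    simp
  · -- slices
    intro i e
    rw [hρ', show (combFlat fun k => centreElem ((fun k => bb (some k)) k)) = F from rfl]
    have e1 : fd (P.1 i e) (gaugeTransform t⁻¹ F e) = fd (gaugeTransform t (P.1 i) e) (F e) := by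
      have h := fd_gaugeTransform_apply t (P.1 i) (gaugeTransform t⁻¹ F) e
      rw [gaugeTransform_gaugeTransform_inv] at h
      exact h.symm
    rw [e1]
    have h1 : fd (gaugeTransform t (P.1 i) e) (gaugeTransform t U e) ≤ 4 * (L : ℝ) * δ := by rw [fd_gaugeTransform_apply]; exact hslice i e
    have h2 := hVw e
    have h3 : fd (combFlat w e) (F e) ≤ 4 * ρ := by
      rw [hF, combFlat_apply, combFlat_apply]
      split_ifs with hx
      · have := hXY (some e.2); rwa [hXs] at this
      · rw [fd_self]; positivity
    calc fd (gaugeTransform t (P.1 i) e) (F e)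
        ≤ fd (gaugeTransform t (P.1 i) e) (gaugeTransform t U e) + (fd (gaugeTransform t U e) (combFlat w e) + fd (combFlat w e) (F e)) :=
          (fd_triangle _ _ _).trans (add_le_add le_rfl (fd_triangle _ _ _))
      _ ≤ 4 * (L : ℝ) * δ + (12 * (L : ℝ) ^ 2 * δ + 4 * ρ) := add_le_add h1 (add_le_add (hV ▸ h2) h3)
      _ = 4 * (L : ℝ) * δ + 12 * (L : ℝ) ^ 2 * δ + 4 * ρ := by ring
  · -- seam
    intro x
    have e0 : t x * centreElem (bb none) * (t x)⁻¹ = c' := by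
      have hcm : t x * centreElem (bb none) = centreElem (bb none) * t x := hYcen none (t x)
      rw [hcm, mul_inv_cancel_right]
    have e1 : fd (g x) (centreElem (bb none)) = fd (sf x) c' := by
      rw [hsf]; dsimp only
      rw [← e0, fd_mul_right, fd_mul_left]
    rw [e1]
    have h1 := hsc x
    have h2 : fd c c' = fd (X none) (Y none) := rfl
    have h3 := hXY none
    calc fd (sf x) c' ≤ fd (sf x) c + fd c c' := fd_triangle _ _ _
      _ ≤ 3 * ((L : ℝ) - 1) * ρ' + 4 * ρ := add_le_add h1 (h2 ▸ h3)
      _ ≤ 12 * (L : ℝ) ^ 2 * δ + 4 * ρ := by rw [hρ']; nlinarith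

end Summit.QuantumFields.YangMills.Theorems.VirialFluxGap.RegularValley

end
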